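import Summits.BirchSwinnertonDyer.BirchSwinnertonDyer.Theorems.KolyvaginDepthDoorDepthTableIntrinsic
import Summits.BirchSwinnertonDyer.BirchSwinnertonDyer.Theorems.KolyvaginDepthDoorDepthTableSteinWuthrichEvenRankBSDQuotientExact
import Summits.BirchSwinnertonDyer.BirchSwinnertonDyer.Theorems.KolyvaginDepthDoorKNSupplyExactReadingZhang
import Literature.NumberTheory.EllipticCurves.Castella2018.TamagawaQuadraticBaseChangeProofs
import HarnessLib

/-!
# Route `KolyvaginDepthDoor`, crux `KolyvaginDepthSupplyKN` (stmt-BirchSwinnertonDyer-22820) —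
# DEPTH TABLE v16, GENERIC: THE INTRINSIC EXACT ROW — «one Kolyvagin bit at `(E, p, K)`» ⟺ «the BSD quotient of the Heegner
# twist is a `p`-adic unit», for EVERY Heegner field and EVERY admissible prime, no hypothesis on the twist model

Helper file of the lead prover of line `levelone` (kdd-p1 g20; `--supports stmt-BirchSwinnertonDyer-22820
--as helper`); it closes nothing and BSD is NOT proved by it.

g19's exact rows (`…RankTwo<label>TwistBSDQuotientExact`, generic `natCard_selmerGroup_le_iff_bsdQuotient_unit_bcs`) needed Kodaira–Néron ON
THE TWIST MODEL to kill the Tamagawa term of Burungale–Castella–Skinner's identity in the converse direction («bit ⟹ unit»). That term is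
read on `E`: for a quadratic field in which every prime of `N_E` splits (Heegner), `ord_p Tam(E^{(d_K)}) = ord_p Tam(E)` for `p ≥ 5` and ANY
model of the twist — the tree theorem `Castella2018.TamagawaQuadratic.padicValNat_tamagawaProduct_quadraticTwist_eq` (Jetchev–Skinner–Wan
2017 §7.3.1 (eq:tamK), proved place by place) —, and `ord_p Tam(E) = 0` is the curve's own Kodaira–Néron condition at `p` (which the crux's
clause carries anyway). Hence:

* `natCard_selmerGroup_le_iff_bsdQuotient_unit_bcs'` — g19's exact reading with `p ∤ Tam(T)` as the hypothesis instead of Kodaira–Néron.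
* `twistSelmer_le_iff_bsdQuotient_unit_intrinsic` — for `W` globally minimal non-CM, `p ≥ 5` good ordinary with `ρ̄_{W,p}` onto and
  Kodaira–Néron at `p`, `K` imaginary quadratic Heegner with `p ∤ d_K`, `T` ANY globally minimal model of `E^{(d_K)}` with
  `ord_{s=1} L(E^{(d_K)}, s) = 1`: `#Sel_p(E^{(d_K)}/ℚ) ≤ p ↔ ∃ q, L'(T,1)/(Ω_T Reg_T) = q ∧ ord_p q = 0`.
* `exactRow_iff_bsdQuotient_unit_intrinsic_spade` — **THE INTRINSIC EXACT ROW on the ♠ cell** for a curve of Mordell–Weil rank EXACTLY `2`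
  in the Stein–Wuthrich range: for EVERY admissible `p`, EVERY Heegner `K` (`d_K ∉ {−3,−4}`, `p ∤ d_K`), ANY minimal twist model `T` with
  `r_an(E^{(d_K)}) = 1`: «∃ frame, Kolyvagin prime `ℓ`, datum: `c_1(ℓ) ≠ 0`» `↔` «`∃ q`, `L'(T,1)/(Ω_T Reg_T) = q ∧ ord_p q = 0`» —
  the Jetchev–Lauter–Stein bit DECIDES the `p`-adic unit-ness of `#Ш_an·Tam` of one rank-one curve, and conversely, at every `(p, K)` at once.

CONDITIONAL on (γ) = Gross 1991 Prop. 3.7 (2), W. Zhang 2014 L8.4 (1) / 9.1, Stein–Wuthrich 2013 Thm. 1.1, Burungale–Castella–Skinner 2025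
Cor. 1.3.1 and GZK, BY NAME; per `(W, p, K)`; nothing class-wide on the open stub (S♭); BSD is NOT proved by any of this.

References: [BurungaleCastellaSkinner2025] Cor. 1.3.1 (p. 4); [JetchevSkinnerWan2017] §7.3.1 (eq:tamK); [Darmon2004] Thm. 3.22;
[GrossLMS1991] Prop. 3.7 (2); [WZhang2014] Lemma 8.4 (1) (p. 236), Thm. 9.1 (p. 240); [SteinWuthrich2013] Thm. 1.1 (p. 1758);
[SilvermanAEC2009] X.4.2, App. C §16.
-/

set_option linter.dupNamespace false

noncomputable section

open scoped Classical NumberField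

namespace Summit.BirchSwinnertonDyer.BirchSwinnertonDyer.Theorems.KolyvaginDepthDoor

open Literature.NumberTheory.EllipticCurves Literature.NumberTheory.EllipticCurves.ModularForms
  WeierstrassCurve NumberField IsDedekindDomain
open Literature.NumberTheory.EllipticCurves.Rank1Residual
open Summit.BirchSwinnertonDyer.BirchSwinnertonDyer.Theorems

/-- **Exact even-rank reading with `p ∤ Tam(T)` as the hypothesis** (instead of Kodaira–Néron on `T`): `T/ℚ` globally minimal non-CM,
`p ≥ 5` good ordinary, `ρ̄_{T,p}` onto, `p ∤ Tam(T)`, `ord_{s=1} L(T,s) = 1`. THEN `#Sel_p(T/ℚ) ≤ p ↔ ∃ q : ℚ, L'(T,1)/(Ω_T·Reg_T) = q ∧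
ord_p q = 0` (GZK; BCS Cor. 1.3.1: `ord_p q = ord_p #Ш(T) + ord_p Tam(T)`; `→` by AEC X.4.2 and Cauchy; `←` by
`natCard_selmerGroup_le_pow_succ_of_rankOne_bsdQuotient_bcs'` with `k = 0`). CONDITIONAL on the two named facts; per `(T, p)`; BSD is not
proved by it. [cite: BurungaleCastellaSkinner2025, Cor. 1.3.1 (p. 4)] [cite: Darmon2004, Thm. 3.22] [cite: SilvermanAEC2009, Thm. X.4.2] -/
theorem natCard_selmerGroup_le_iff_bsdQuotient_unit_bcs'
    (hBCS : BurungaleCastellaSkinner2025.cor131_padicValRat_bsd_rank_le_one)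
    (hGZK : rank_eq_analyticRank_of_analyticRank_le_one)
    (T : WeierstrassCurve ℚ) [T.IsElliptic] [T.IsGloballyMinimal] (p : ℕ) [hp : Fact p.Prime] (h5 : 5 ≤ p)
    (hcm : ¬ T.HasCM) (hgood : T.HasGoodReductionAtPrime p) (hord : ¬ (p : ℤ) ∣ T.frobeniusTrace p)
    (hsur : T.HasSurjectiveModNGaloisRep p) (htam : ¬ p ∣ T.tamagawaProduct)
    (hr : T.analyticRank = 1) :
    Nat.card (T.selmerGroup p) ≤ p ↔
      ∃ q : ℚ, T.leadingLCoeff / ((T.realPeriodRat * T.regulator : ℝ) : ℂ) = (q : ℂ) ∧ padicValRat p q = 0 := by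
  have hirr : T.HasIrreducibleModPGaloisRep p := hasIrreducibleModPGaloisRep_of_hasSurjectiveModNGaloisRep T p hsur
  have him : BigIm T p := Summit.BirchSwinnertonDyer.Rank1Residual.X9.bigIm_of_surj T p h5 hsur
  obtain ⟨hrank, hfin⟩ := hGZK T (by rw [hr])
  rw [hr] at hrank
  haveI : Finite T.sha := hfin
  obtain ⟨q, hq, hv⟩ := hBCS T p hcm (by omega) ⟨hgood, hord⟩ hirr him (by rw [hr]) hfin
  have htam0 : padicValNat p T.tamagawaProduct = 0 := padicValNat.eq_zero_of_not_dvd htam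
  constructor
  · intro hle
    have hbot := ((natCard_selmerGroup_le_iff_rank_eq_one_sha₁₅ T p hirr (by rw [hrank])).mp
      (by exact_mod_cast hle)).2
    have hnd : ¬ p ∣ T.shaOrder := by
      rw [WeierstrassCurve.shaOrder]; exact not_dvd_natCard_sha_of_sha_inf_torsionBy_eq_bot T p hbot
    have hsha0 : padicValNat p T.shaOrder = 0 := padicValNat.eq_zero_of_not_dvd hnd
    exact ⟨q, hq, by rw [hv, hsha0, htam0]; norm_num⟩
  · rintro ⟨q', hq', hv'⟩
    have hle := natCard_selmerGroup_le_pow_succ_of_rankOne_bsdQuotient_bcs' hBCS hGZK T p h5 hcm hgood hord hsur hr 0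
      (fun q'' hq'' ↦ by
        have hqq : q'' = q' := by
          have h := hq''.symm.trans hq'
          exact_mod_cast h
        rw [hqq, hv']; exact_mod_cast le_rfl)
    simpa using hle

/-- **`p ∤ Tam(T)` for ANY model `T` of a Heegner twist, from Kodaira–Néron of the CURVE** (`p ≥ 5`): under the Heegner hypothesis every
prime of `N_E` splits in `K`, so `ord_p Tam(E^{(d_K)}) = ord_p Tam(E)` (tree theorem
`Castella2018.TamagawaQuadratic.padicValNat_tamagawaProduct_quadraticTwist_eq`, Jetchev–Skinner–Wan 2017 §7.3.1 (eq:tamK), its bad-prime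
binder vacuous), and `p ∤ Tam(E)` on the Kodaira–Néron cell (`not_dvd_tamagawaProduct_of_kodairaNeron`).
[cite: JetchevSkinnerWan2017, §7.3.1 (eq:tamK)] [cite: SilvermanAEC2009, App. C §16, VII.6.1] -/
theorem not_dvd_tamagawaProduct_twist_of_kodairaNeron (W : WeierstrassCurve ℚ) [W.IsElliptic] [W.IsGloballyMinimal]
    (p : ℕ) [hp : Fact p.Prime] (h5 : 5 ≤ p)
    (hKN : ∀ v : HeightOneSpectrum (𝓞 ℚ), W.HasMultiplicativeReductionAt v → ¬ p ∣ W.ordMinimalDiscriminant v)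
    (K : Type) [Field K] [NumberField K] (hK : IsImaginaryQuadratic K)
    [NeZero (W.conductorNorm ℤ)] (hH : SatisfiesHeegnerHypothesis (W.conductorNorm ℤ) K)
    (T : WeierstrassCurve ℚ) [T.IsElliptic] (C : VariableChange ℚ)
    (hC : C • T = W.quadraticTwist (NumberField.discr K : ℚ)) :
    ¬ p ∣ T.tamagawaProduct := by
  have hbad : ∀ (ℓ : ℕ) [Fact ℓ.Prime], ℓ ∣ W.conductorNorm ℤ →
      ¬ ((Ideal.span {(ℓ : ℤ)}).primesOver (𝓞 K)).ncard = 2 →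
        Mult W ℓ ∧ ¬ p ∣ padicValInt ℓ W.minimalDiscriminantInt :=
    fun ℓ _ hℓN hns ↦ absurd (hH ℓ Fact.out hℓN) hns
  have heq := Castella2018.TamagawaQuadratic.padicValNat_tamagawaProduct_quadraticTwist_eq W p K T h5 hK.1 hbad
    ⟨C⁻¹, by rw [← hC, inv_smul_smul]⟩
  intro hdvd
  have hW : ¬ p ∣ W.tamagawaProduct := not_dvd_tamagawaProduct_of_kodairaNeron W p h5 hKN
  have hT0 : T.tamagawaProduct ≠ 0 := (WeierstrassCurve.tamagawaProduct_pos' T).ne'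
  have h1 : 1 ≤ padicValNat p T.tamagawaProduct := (padicValNat_dvd_iff_le hT0).mp (by simpa using hdvd)
  have h2 : padicValNat p W.tamagawaProduct = 0 := padicValNat.eq_zero_of_not_dvd hW
  omega

/-- **THE INTRINSIC TWIST READING: `#Sel_p(E^{(d_K)}/ℚ) ≤ p` ⟺ the BSD quotient of the Heegner twist is a `p`-adic unit — on ANY
globally minimal model, every side condition on `E`.** `W` globally minimal non-CM; `p ≥ 5` good ordinary for `W`, `ρ̄_{W,p}` onto,
Kodaira–Néron at `p`; `K` imaginary quadratic Heegner for `N_E` with `p ∤ d_K`; `T` any globally minimal model of `E^{(d_K)}`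
(`C • T = W.quadraticTwist d_K`) with `ord_{s=1} L(E^{(d_K)}, s) = 1`. THEN `#Sel_p(E^{(d_K)}/ℚ) ≤ p ↔ ∃ q, L'(T,1)/(Ω_T·Reg_T) = q ∧
ord_p q = 0` (non-CM / surjectivity / good ordinary of `T` DERIVED as in `…DepthTableIntrinsic`; `p ∤ Tam(T)` by
`not_dvd_tamagawaProduct_twist_of_kodairaNeron`; Selmer transport). CONDITIONAL on BCS Cor. 1.3.1 and GZK by name; BSD is not proved by it.
[cite: BurungaleCastellaSkinner2025, Cor. 1.3.1 (p. 4)] [cite: Darmon2004, Thm. 3.22] [cite: JetchevSkinnerWan2017, §7.3.1 (eq:tamK)] -/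
theorem twistSelmer_le_iff_bsdQuotient_unit_intrinsic
    (hBCS : BurungaleCastellaSkinner2025.cor131_padicValRat_bsd_rank_le_one)
    (hGZK : rank_eq_analyticRank_of_analyticRank_le_one)
    (W : WeierstrassCurve ℚ) [W.IsElliptic] [W.IsGloballyMinimal] (hcm : ¬ W.HasCM)
    (p : ℕ) [hp : Fact p.Prime] (h5 : 5 ≤ p) (hgood : W.HasGoodReductionAtPrime p)
    (hord : ¬ (p : ℤ) ∣ W.frobeniusTrace p) (hsur : W.HasSurjectiveModNGaloisRep p)
    (hKN : ∀ v : HeightOneSpectrum (𝓞 ℚ), W.HasMultiplicativeReductionAt v → ¬ p ∣ W.ordMinimalDiscriminant v)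
    (K : Type) [Field K] [NumberField K] (hK : IsImaginaryQuadratic K)
    (hpD : ¬ ((p : ℤ) ∣ NumberField.discr K))
    [NeZero (W.conductorNorm ℤ)] (hH : SatisfiesHeegnerHypothesis (W.conductorNorm ℤ) K)
    (T : WeierstrassCurve ℚ) [T.IsElliptic] [T.IsGloballyMinimal] (C : VariableChange ℚ)
    (hC : C • T = W.quadraticTwist (NumberField.discr K : ℚ))
    (hTr : (W.quadraticTwist (NumberField.discr K : ℚ)).analyticRank = 1) :
    Nat.card ((W.quadraticTwist (NumberField.discr K : ℚ)).selmerGroup p) ≤ p ↔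
      ∃ q : ℚ, T.leadingLCoeff / ((T.realPeriodRat * T.regulator : ℝ) : ℂ) = (q : ℂ) ∧ padicValRat p q = 0 := by
  have hd0 : NumberField.discr K ≠ 0 := NumberField.discr_ne_zero K
  have hdq : (NumberField.discr K : ℚ) ≠ 0 := by exact_mod_cast hd0
  haveI := W.isElliptic_quadraticTwist hdq
  have hpP : p.Prime := hp.out
  have hTcm : ¬ T.HasCM := by
    intro hT
    have h1 : (C • T).HasCM := hasCM_variableChange T C hT
    rw [hC] at h1
    exact not_hasCM_quadraticTwist W hdq hcm h1
  have hTsur : T.HasSurjectiveModNGaloisRep p := hasSurjectiveModNGaloisRep_of_smul_eq_quadraticTwist W T hdq hC p hsur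
  have hp2d : ¬ ((p : ℤ) ∣ 2 * NumberField.discr K) := by
    intro h
    rcases (Nat.prime_iff_prime_int.mp hpP).dvd_or_dvd h with h2 | h2
    · have : p = 2 := (Nat.prime_dvd_prime_iff_eq hpP Nat.prime_two).mp (by exact_mod_cast h2)
      omega
    · exact hpD h2
  obtain ⟨hTgood, hTord⟩ := goodOrdinary_of_smul_eq_quadraticTwist_of_ne_zero W T hd0 hC p hp2d hgood hord
  have hTr' : T.analyticRank = 1 := by rw [← hTr, ← hC, analyticRank_smul]
  have htam : ¬ p ∣ T.tamagawaProduct := not_dvd_tamagawaProduct_twist_of_kodairaNeron W p h5 hKN K hK hH T C hC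
  rw [← natCard_selmerGroup_eq_of_variableChange (p : ℤ) hC]
  exact natCard_selmerGroup_le_iff_bsdQuotient_unit_bcs' hBCS hGZK T p h5 hTcm hTgood hTord hTsur htam hTr'

/-- **THE INTRINSIC EXACT ROW ON THE ♠ CELL — «ONE KOLYVAGIN BIT ⟺ THE BSD QUOTIENT OF THE HEEGNER TWIST IS A `p`-ADIC UNIT», every
Heegner field, every admissible prime, no hypothesis on the twist model.** `W` globally minimal, non-CM, `rank_ℤ W(ℚ) = 2`, `N_E ≤ 30 000`;
`5 ≤ p < 1000` good ordinary, `ρ_{W,p^n}` onto, Kodaira–Néron, ♠ (1), ♠ (2); `K` ANY imaginary quadratic Heegner field with `d_K ∉ {−3,−4}`,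
`p ∤ d_K`; `T` ANY globally minimal model of `E^{(d_K)}` with `ord_{s=1} L(E^{(d_K)}, s) = 1`. THEN
«∃ frame, Kolyvagin prime `ℓ`, datum of conductor `ℓ` with `c_1(ℓ) ≠ 0`» `↔` «`∃ q : ℚ`, `L'(T,1)/(Ω_T·Reg_T) = q ∧ ord_p q = 0`»:
g14's two-sided reading `kolyvaginClass_prime_ne_zero_iff_shaTrivial_twistSelmer_of_rank_two_of_lemma84` ((γ) + Zhang), `Ш(E)[p] = 0` by
Stein–Wuthrich, and `twistSelmer_le_iff_bsdQuotient_unit_intrinsic`. CONDITIONAL on (γ), W. Zhang L8.4 (1) / 9.1, Stein–Wuthrich Thm. 1.1,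
BCS Cor. 1.3.1, GZK by name; per `(W, p, K)`; nothing class-wide; BSD is not proved by it. [cite: GrossLMS1991, Prop. 3.7 (2)]
[cite: WZhang2014, Lemma 8.4 (1) (p. 236), Thm. 9.1 (p. 240)] [cite: SteinWuthrich2013, Thm. 1.1 (p. 1758)]
[cite: BurungaleCastellaSkinner2025, Cor. 1.3.1 (p. 4)] [cite: JetchevLauterStein2009, §3.6 (arXiv:0707.0032)] -/
theorem exactRow_iff_bsdQuotient_unit_intrinsic_spade
    (h372 : GrossLMS1991.prop37_2_frobeniusCongruence)
    (h84 : Literature.NumberTheory.EllipticCurves.WZhang2014_lemma84_exists_minimal_kolyvaginClass_one_selmerCard)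
    (hSW : SteinWuthrich2013_sha_inf_torsionBy_eq_bot_of_two_le_rank)
    (hBCS : BurungaleCastellaSkinner2025.cor131_padicValRat_bsd_rank_le_one)
    (hGZK : rank_eq_analyticRank_of_analyticRank_le_one)
    (W : WeierstrassCurve ℚ) [W.IsElliptic] [W.IsGloballyMinimal] (hcm : ¬ W.HasCM) (hr : W.mordellWeilRank = 2)
    (hN : W.conductorNorm ℤ ≤ 30000)
    (p : ℕ) [hp : Fact p.Prime] (h5 : 5 ≤ p) (hp1000 : p < 1000) (hgood : W.HasGoodReductionAtPrime p)
    (hord : ¬ (p : ℤ) ∣ W.frobeniusTrace p)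
    (htower : ∀ n : ℕ, W.HasSurjectiveModNGaloisRep (p ^ n : ℕ))
    (hKN : ∀ v : HeightOneSpectrum (𝓞 ℚ), W.HasMultiplicativeReductionAt v →
      ¬ p ∣ W.ordMinimalDiscriminant v)
    (hS1 : ∀ (ℓ : ℕ) [Fact ℓ.Prime], W.HasMultiplicativeReductionAtPrime ℓ →
      ¬ p ∣ padicValInt ℓ W.minimalDiscriminantInt)
    (hS2 : ¬ Squarefree (W.conductorNorm ℤ) →
      (∃ (ℓ : ℕ) (_ : Fact ℓ.Prime), W.HasMultiplicativeReductionAtPrime ℓ ∧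
          ¬ p ∣ padicValInt ℓ W.minimalDiscriminantInt) ∧
        ∃ (ℓ₁ ℓ₂ : ℕ) (_ : Fact ℓ₁.Prime) (_ : Fact ℓ₂.Prime), ℓ₁ ≠ ℓ₂ ∧
          W.HasMultiplicativeReductionAtPrime ℓ₁ ∧ W.HasMultiplicativeReductionAtPrime ℓ₂)
    (K : Type) [Field K] [NumberField K] (hK : IsImaginaryQuadratic K)
    (hD3 : NumberField.discr K ≠ -3) (hD4 : NumberField.discr K ≠ -4)
    (hpD : ¬ ((p : ℤ) ∣ NumberField.discr K))
    [NeZero (W.conductorNorm ℤ)] (hH : SatisfiesHeegnerHypothesis (W.conductorNorm ℤ) K)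
    (T : WeierstrassCurve ℚ) [T.IsElliptic] [T.IsGloballyMinimal] (C : VariableChange ℚ)
    (hC : C • T = W.quadraticTwist (NumberField.discr K : ℚ))
    (hTr : (W.quadraticTwist (NumberField.discr K : ℚ)).analyticRank = 1) :
    (∃ (Dt : ModularParametrizationData W (W.conductorNorm ℤ)) (β : ℤ) (ι : K →+* ℂ) (ℓ : ℕ)
      (d : KolyvaginHeegnerData Dt β ι ℓ),
      ℓ.Prime ∧ Zhang2014.IsKolyvaginPrime (W.conductorNorm ℤ) W K p ℓ ∧
        d.kolyvaginClass hp.out 1 ≠ 0) ↔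
    ∃ q : ℚ, T.leadingLCoeff / ((T.realPeriodRat * T.regulator : ℝ) : ℂ) = (q : ℂ) ∧ padicValRat p q = 0 := by
  have hsur : W.HasSurjectiveModNGaloisRep p := by simpa only [pow_one] using htower 1
  have hsha : (W.sha ⊓ AddSubgroup.torsionBy W.galH1 (p : ℤ) : AddSubgroup W.galH1) = ⊥ :=
    hSW W hcm (by rw [hr]) hN p h5 hp1000 hgood hord hsur
  rw [kolyvaginClass_prime_ne_zero_iff_shaTrivial_twistSelmer_of_rank_two_of_lemma84 h372 h84 W hcm p h5 hgood hord htower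
    hKN hS1 hS2 K hK hD3 hD4 hpD hH hr, and_iff_right hsha]
  exact twistSelmer_le_iff_bsdQuotient_unit_intrinsic hBCS hGZK W hcm p h5 hgood hord hsur hKN K hK hpD hH T C hC hTr

end Summit.BirchSwinnertonDyer.BirchSwinnertonDyer.Theorems.KolyvaginDepthDoor

end
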